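import Summits.CriticalPhenomena.PercolationContinuityZ3.Theorems.Transplant.FKConnectivityAllQHubCovPendant
import Summits.CriticalPhenomena.PercolationContinuityZ3.Theorems.Transplant.FKConnectivityAllQHubCovPinning
import Summits.CriticalPhenomena.PercolationContinuityZ3.Theorems.Transplant.FKConnectivityAllQTwoTree
import HarnessLib

/-!
# Connectivity correlation inequalities for `φ_{w,q}`, every `q > 0` — DEGREE-THREE ELIMINATION for adjacent-edge negative
# correlation, at the level of supports

Support file (`--supports stmt-CriticalPhenomena-4575`), FK sub-lane `prim-bschramm-fk-1` (gen 7) of the post-continuity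
programme; builds on p205010 (kernel theorem, internal audit signed; external expert review pending).  One definition
(`NegCorrPairSupp`, the per-pair form of fk-1 g5's `EdgeNegCorrSupp`), no named facts, no sorries; standard axioms.

THE TOOL.  fk-3 g7 proved the pendant-hub reduction `negCorr_adj_of_degree_three`: negative correlation of the adjacent pairs
`xy, xz` under `φ_{w,q}` at a vertex `x` whose only live pairs are `xy, xz, xu` follows from the hub covariance bound for
`w[xy ↦ 0][xz ↦ 0][xu ↦ 0]` at the hub `u` and the pair `y, z`; the pinning identity (`hubCovBoundUnder_of_pinned`) moves that
bound to the state with `uy, uz` switched off, and `hubCovBoundUnder_of_negCorr_half` obtains it there from ONE instance of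
negative correlation of `uy, uz` in the state `·[uy ↦ ½][uz ↦ ½]`.  Composing the three gives a purely support-level statement
(`negCorrPairSupp_of_degree_three`): **if `x`'s pairs in `S` are among `xy, xz, xu`, then negative correlation of `(uy, uz)` for
every weight vector supported in `{e ∈ S | x ∉ e} ∪ {uy, uz}` implies negative correlation of `(xy, xz)` for every weight vector
supported in `S`** (`0 < q ≤ 1`; `q = 1` is the product measure).  In graph language: NC at a degree-three vertex `x` of `G`
reduces to NC at its third neighbour `u` in `(G − x) + uy + uz`, a graph with one vertex fewer in play.  File `…Wheels` iterates
this inside one vertex type to prove adjacent-edge negative correlation at every rim vertex of every wheel.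
[cite: Grimmett2006, §3.9 eq. (3.94) (p. 63); Thm. (3.1)(a) (p. 37)] [cite: Wagner2006, Conj. 5.3 (p. 13)]
-/

noncomputable section

namespace Summit.CriticalPhenomena.PercolationContinuityZ3.Theorems

namespace FK

open MeasureTheory Set Literature.Probability.LatticeModels Literature.Probability.Percolation
open scoped Classical

variable {V : Type*} [Fintype V]

/-! ### Negative correlation of ONE pair of pairs on a support -/

/-- **Negative correlation of the pair of pairs `(e, f)` under every `φ_{w,q}` supported in `S`**:
`φ_w(J_e ∩ J_f) ≤ φ_w(J_e)·φ_w(J_f)` for all `w` with `{g | w g ≠ 0} ⊆ S` — the per-pair slice of `EdgeNegCorrSupp S q`.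
[cite: Grimmett2006, §3.9 eq. (3.94) (p. 63)] -/
def NegCorrPairSupp (S : Set (Sym2 V)) (q : ℝ) (e f : Sym2 V) : Prop :=
  ∀ w : Sym2 V → unitInterval, (∀ g, ((w g : unitInterval) : ℝ) ≠ 0 → g ∈ S) →
    (rcMeasureW w q ∅).real ({ω | e ∈ ω} ∩ {ω | f ∈ ω}) ≤
      (rcMeasureW w q ∅).real {ω | e ∈ ω} * (rcMeasureW w q ∅).real {ω | f ∈ ω}

/-- A smaller support inherits negative correlation of the pair. [cite: Grimmett2006, §3.9 eq. (3.94) (p. 63)] -/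
theorem NegCorrPairSupp.mono {S T : Set (Sym2 V)} {q : ℝ} {e f : Sym2 V} (hST : S ⊆ T) (h : NegCorrPairSupp T q e f) :
    NegCorrPairSupp S q e f :=
  fun w hw => h w (fun g hg => hST (hw g hg))

/-- Negative correlation of `(e, f)` is negative correlation of `(f, e)`. [folklore] -/
theorem NegCorrPairSupp.symm {S : Set (Sym2 V)} {q : ℝ} {e f : Sym2 V} (h : NegCorrPairSupp S q e f) :
    NegCorrPairSupp S q f e := by
  intro w hw
  rw [Set.inter_comm, mul_comm]
  exact h w hw

/-- Edge-negative association on `S` gives every pair slice. [cite: Grimmett2006, §3.9 eq. (3.94) (p. 63)] -/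
theorem negCorrPairSupp_of_edgeNegCorrSupp {S : Set (Sym2 V)} {q : ℝ} (h : EdgeNegCorrSupp S q) {e f : Sym2 V}
    (he : ¬ e.IsDiag) (hfe : f ≠ e) : NegCorrPairSupp S q e f :=
  fun w hw => h w hw e f he hfe

omit [Fintype V] in
/-- Two pairs `s(a, b) ≠ s(a, c)` at a common vertex when `b ≠ c`. [folklore] -/
theorem sym2_mk_ne_mk_left {a b c : V} (hbc : b ≠ c) : s(a, b) ≠ s(a, c) := by
  intro h
  rw [Sym2.eq_iff] at h
  rcases h with ⟨-, h⟩ | ⟨h1, h2⟩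
  · exact hbc h
  · exact hbc (h2.trans h1)

/-! ### Degree-three elimination -/

/-- **DEGREE-THREE ELIMINATION (support level).**  Let `0 < q ≤ 1`, let `x, u, y, z` be distinct, and let `S` be an edge set whose
pairs at `x` are among `xy, xz, xu`.  If the pair `(uy, uz)` is negatively correlated under every `φ_{v,q}` supported in
`{e ∈ S | x ∉ e} ∪ {uy, uz}`, then the pair `(xy, xz)` is negatively correlated under every `φ_{w,q}` supported in `S`.
(fk-3 g7's pendant-hub reduction + pinning + one negative-correlation instance in the state `[uy ↦ ½][uz ↦ ½]`; `q = 1`: product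
measure.)  In graph terms: negative correlation of `xy, xz` at a degree-three vertex `x` of `G` follows from negative correlation
of `uy, uz` in `(G − x) + uy + uz`. [cite: Grimmett2006, §3.9 eq. (3.94) (p. 63); Thm. (3.1)(a) (p. 37)] -/
theorem negCorrPairSupp_of_degree_three {q : ℝ} (hq0 : 0 < q) (hq1 : q ≤ 1) {S : Set (Sym2 V)} {x u y z : V}
    (hxu : x ≠ u) (hxy : x ≠ y) (hxz : x ≠ z) (hyu : y ≠ u) (hzu : z ≠ u) (hyz : y ≠ z)
    (hS : ∀ e ∈ S, x ∈ e → e = s(x, y) ∨ e = s(x, z) ∨ e = s(x, u))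
    (h : NegCorrPairSupp ({e ∈ S | x ∉ e} ∪ {s(u, y), s(u, z)}) q s(u, y) s(u, z)) :
    NegCorrPairSupp S q s(x, y) s(x, z) := by
  intro w hw
  rcases hq1.lt_or_eq with hlt | rfl
  swap
  · exact negCorr_of_q_one w _ _ (sym2_mk_ne_mk_left (Ne.symm hyz))
  refine negCorr_adj_of_degree_three hq0 hq1 w hxu hxy hxz hyu hzu hyz (fun e hxe hne => hS e (hw e hne) hxe) ?_
  set W : Sym2 V → unitInterval :=
    Function.update (Function.update (Function.update w s(x, y) 0) s(x, z) 0) s(x, u) 0 with hW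
  refine hubCovBoundUnder_of_pinned hq0 W u y z ?_
  set W' : Sym2 V → unitInterval := Function.update (Function.update W s(u, y) 0) s(u, z) 0 with hW'
  have hyz' : s(u, z) ≠ s(u, y) := sym2_mk_ne_mk_left (Ne.symm hyz)
  have h1 : ((W' s(u, y) : unitInterval) : ℝ) = 0 := by
    rw [hW', Function.update_of_ne (Ne.symm hyz'), Function.update_self]; rfl
  have h2 : ((W' s(u, z) : unitInterval) : ℝ) = 0 := by
    rw [hW', Function.update_self]; rfl
  refine hubCovBoundUnder_of_negCorr_half hq0 hlt W' u y z h1 h2 hyz (h _ ?_)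
  intro g hg
  by_cases hgz : g = s(u, z)
  · exact Or.inr (Or.inr hgz)
  by_cases hgy : g = s(u, y)
  · exact Or.inr (Or.inl hgy)
  -- otherwise the weight of `g` is that of `W`, hence of `w`, and `g` avoids `x`
  have hWg : ((W g : unitInterval) : ℝ) ≠ 0 := by
    rw [Function.update_of_ne hgz, Function.update_of_ne hgy, hW', Function.update_of_ne hgz,
      Function.update_of_ne hgy] at hg
    exact hg
  have hg1 : g ≠ s(x, y) := by
    intro hh; apply hWg; rw [hW, hh, Function.update_of_ne, Function.update_of_ne, Function.update_self]
    · rfl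
    · exact sym2_mk_ne_mk_left hyz
    · exact sym2_mk_ne_mk_left hyu
  have hg2 : g ≠ s(x, z) := by
    intro hh; apply hWg; rw [hW, hh, Function.update_of_ne, Function.update_self]
    · rfl
    · exact sym2_mk_ne_mk_left hzu
  have hg3 : g ≠ s(x, u) := by
    intro hh; apply hWg; rw [hW, hh, Function.update_self]; rfl
  have hwg : ((w g : unitInterval) : ℝ) ≠ 0 := by
    rw [hW, Function.update_of_ne hg3, Function.update_of_ne hg2, Function.update_of_ne hg1] at hWg
    exact hWg
  have hgS : g ∈ S := hw g hwg
  refine Or.inl ⟨hgS, fun hxg => ?_⟩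
  rcases hS g hgS hxg with hh | hh | hh
  · exact hg1 hh
  · exact hg2 hh
  · exact hg3 hh

/-- **Degree-three elimination into a negatively associated support.**  If `x`'s pairs in `S` are among `xy, xz, xu` and
`{e ∈ S | x ∉ e} ∪ {uy, uz}` lies inside an edge set `T` on which `φ_{·,q}` is edge-negatively associated (e.g. a 2-tree, a `K₄`,
or anything glued from them), then `(xy, xz)` is negatively correlated under every `φ_{w,q}` supported in `S` (`0 < q ≤ 1`).
[cite: Grimmett2006, §3.9 eq. (3.94) (p. 63)] [cite: Wagner2006, Thm. 5.8(d), §5.3] -/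
theorem negCorrPairSupp_of_degree_three_of_edgeNegCorrSupp {q : ℝ} (hq0 : 0 < q) (hq1 : q ≤ 1) {S T : Set (Sym2 V)}
    {x u y z : V} (hxu : x ≠ u) (hxy : x ≠ y) (hxz : x ≠ z) (hyu : y ≠ u) (hzu : z ≠ u) (hyz : y ≠ z)
    (hS : ∀ e ∈ S, x ∈ e → e = s(x, y) ∨ e = s(x, z) ∨ e = s(x, u))
    (hT : EdgeNegCorrSupp T q) (hST : {e ∈ S | x ∉ e} ∪ {s(u, y), s(u, z)} ⊆ T) :
    NegCorrPairSupp S q s(x, y) s(x, z) :=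
  negCorrPairSupp_of_degree_three hq0 hq1 hxu hxy hxz hyu hzu hyz hS
    ((negCorrPairSupp_of_edgeNegCorrSupp hT (by rw [Sym2.mk_isDiag_iff]; exact hyu.symm)
      (sym2_mk_ne_mk_left (Ne.symm hyz))).mono hST)

end FK

end Summit.CriticalPhenomena.PercolationContinuityZ3.Theorems

end
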